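/-
Copyright (c) 2026 the pub-hodgecm-mathlib formalisation cell (harness21).  Prover seat hodgecm-mathlib-F0P3b-p01 (g12), 2026-09-01.  Road «S3-tree», LIFT rider (H2D)
«2-DEEP REPRESENTATIVES, TYPE (1)» (architect A-p16 (g30) A-118 (2) ∕ A-121 (2) ∕ A-127 (1) ∕ A-128), over ★ organs p846535 (F0P3-p01 (g16)) and the seat's ★ P-1 frames.
-/
import Literature.NumberTheory.Rogawski1990.LocalTransferExplicitNonsplit
import Literature.NumberTheory.Rogawski1990.LocalTransferGlueCM
import Literature.NumberTheory.Automorphic.OrbitalMeasureCanonical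
import Literature.NumberTheory.Rogawski1990.LocalTransferGlueNhdsOne
import Literature.NumberTheory.Rogawski1990.UnitFundamentalLemmaExplicitNonsplitClosedProof
import Literature.NumberTheory.Automorphic.IntegralMatrixReduction
import Literature.NumberTheory.Rogawski1990.TwoDeepRepresentativesTypeOneOrgans        -- ★ p846535 (F0P3-p01 (g16)): support = the four matched classes; literal depth
import Literature.NumberTheory.Rogawski1990.EndoscopicLeviTorusTransport              -- ★ `endoEmbLocal_mem_cmLocalIntegralLevel_iff`
import Literature.NumberTheory.Automorphic.NonsplitPlaceHaarBallRatios                -- ★ `isUnit_toLocalRing_uniformizer`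
import Literature.NumberTheory.Automorphic.UnitaryLatticeTreeFixedVertexCharpoly       -- ★ `v_det_eq_one_of_mem_unitary`
import Literature.NumberTheory.Automorphic.UnitaryTwoRamifiedTreeStabilizers           -- ★ `mem_glInt_iff_forall_v_le_one_and_v_det_eq_one`
import Literature.NumberTheory.Rogawski1990.ValuedTwoPlacesOver                        -- ★ `valued_two_eq_one_iff_of_placesOver`
import HarnessLib

/-!
# LIFT rider (H2D), type (1): near `1 ∈ H_v` every `Δ‴`-support class of a type-(1) `γ_H` meeting `K` has a `K`-representative `≡ 1 (mod ϖ_v²)` at `w`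
# (Rogawski 1990 Prop. 4.9.1; Flicker 1998 §6)

Topic `NumberTheory/Rogawski1990`; namespace `Literature.NumberTheory.Rogawski1990`.  THEOREMS ONLY (no definition, no instance, no notation, no named fact, no `sorry`);
kernel lane `--supports stmt-HodgeConjecture-24833`.  Cell `pub/hodgecm-mathlib`, crux H413; road «S3-tree», END fold v3.2 `stub_twoDeepRep_typeOne` :294–:320 VERBATIM as
`exists_twoDeepRepresentative_of_finExplicitDelta_ne_zero_typeOne` (twin of F0P3-p04 (g12)'s type-(2) rider).  HONEST LABEL: HC_CM is proved only modulo the 2 remaining named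
inputs (hLiu418 24832, h413 24833) until rung 0 closes; this file assembles ★ organs and asserts nothing printed.

THE PROOF.  `V := K_H ∩ {|tr g_w − 2|_w < |ϖ|⁶} ∩ {|det g_w − 1|_w < |ϖ|⁶} ∩ {|u_w − 1|_w < |ϖ|³}` (so the eigen-data `α, γ, u_w` is 3-DEEP: `(α−1)² = (tr−2)α − (det−1)`).
Frames as in ★ `depthZeroKappaTransfer_typeOne_at`: exponents, Flicker's scalars with `π := ι_v(ϖ_v)` (a σ-fixed non-norm: norms have even valuation at the inert `w`),
eigenframe, the four matched representatives `t₁ … t₄` under ONE congruence `ψ = Tl · Tl⁻¹` (★ `exists_four_matched_flicker_representatives`).  SUPPORT: ★ organ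
`mk_eq_or_of_finExplicitDelta_out_ne_zero` ⇒ the class is `⟦tᵢ⟧`.  TRANSPORT (no integrality of `Tl` needed): `Tl_w⁻¹` carries the unimodular Gram `Φ₃ ↦ H′_w` (`hform`
read at `w`), so ★ L1 `exists_mem_unitaryGroupOfForm_mul_of_selfDual_of_nonsplit` factors `Tl_w⁻¹ = u·k`, `u ∈ U(H′_w) = e(G′_v)`, `k ∈ GL₃(𝒪_w)`; the representative
`γ₀ := e⁻¹(u)⁻¹·tᵢ·e⁻¹(u)` lies in `⟦tᵢ⟧`, has `e(γ₀) = k·(τᵢ)_w·k⁻¹` (`τᵢ = ψ tᵢ` Flicker's literal), hence `γ₀ ∈ K` (★ `mem_localIntegralLevel_iff_of_smul_eq`) and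
`e(γ₀) ≡ 1 (mod ϖ_v²)` entrywise from ★ organ `valuation_flickerLiteralPi∕One_sub_one_le` at `D = |ϖ|²` (3-deep eigen-data, `|π′| = |ϖ|⁻¹`).

CONTENTS.  `exists_conj_mem_localIntegralLevel_of_literal` (the transport step, standalone); `twoDeepRep_typeOne_at` (the rider AT one matched
`γ_H ∈ K_H` with 3-deep eigen-data); HEAD `exists_twoDeepRepresentative_of_finExplicitDelta_ne_zero_typeOne` (the neighbourhood `V`; the `μ`-binders
`_hμ _hμu _hμω` of the fold are kept for the signature and are not used: the `Δ‴`-support organ needs no hypothesis on `μ`).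

## References
* [Rogawski1990] J. D. Rogawski, *Automorphic Representations of Unitary Groups in Three Variables* (1990): §4.9 Prop. 4.9.1 (a) p. 55; §4.3 (4.3.1)–(4.3.2) p. 43; §3.5 Prop. 3.5.2.
* [Flicker1998UnitaryFL] Y. Z. Flicker, *Elementary proof of the fundamental lemma for a unitary group*, Canad. J. Math. 50 (1998): Prop. 3 p. 78; §6 pp. 95–97.
* [Jacobowitz1962] R. Jacobowitz, *Hermitian forms over local fields*, Amer. J. Math. 84 (1962): §7 Thm. 7.1 (the self-dual locus is `U·GL_n(𝒪)`).
-/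

set_option autoImplicit false

noncomputable section

open NumberField IsDedekindDomain MeasureTheory Measure Topology Filter Matrix Polynomial
open Literature.NumberTheory.Rogawski1990 Literature.NumberTheory.Automorphic Literature.NumberTheory.GaloisRepresentations
open Literature.NumberTheory.Automorphic.UnitaryGroup Literature.NumberTheory.Automorphic.IntegralReduction
open scoped Matrix MatrixGroups ValuativeRel

namespace Literature.NumberTheory.Rogawski1990

/-- Flicker's `π`-literal read at a place `w ∣ v`: entrywise evaluation. [cite: Flicker1998UnitaryFL, Prop. 3 p. 78] -/
private theorem map_evalRingHom_flickerLiteralPi (L : Type) [Field L] [NumberField L]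
    (v : HeightOneSpectrum (𝓞 ↥(maximalRealSubfield L))) (w : PlacesOver L v) (e x₁ x₂ x₃ p q : LocalRing L v) :
    (!![e * (x₁ + x₃), 0, -(e * (x₁ - x₃) * p); 0, x₂, 0; -(e * (x₁ - x₃) * q), 0, e * (x₁ + x₃)] :
        Matrix (Fin 3) (Fin 3) (LocalRing L v)).map (Pi.evalRingHom (fun w' : PlacesOver L v => w'.1.adicCompletion L) w) =
      !![e w * (x₁ w + x₃ w), 0, -(e w * (x₁ w - x₃ w) * p w); 0, x₂ w, 0; -(e w * (x₁ w - x₃ w) * q w), 0, e w * (x₁ w + x₃ w)] :=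
  Matrix.ext fun a b => by fin_cases a <;> fin_cases b <;> rfl

/-- Flicker's `θ̄ = 0` literal read at a place `w ∣ v`: entrywise evaluation. [cite: Flicker1998UnitaryFL, Prop. 3 p. 78] -/
private theorem map_evalRingHom_flickerLiteralOne (L : Type) [Field L] [NumberField L]
    (v : HeightOneSpectrum (𝓞 ↥(maximalRealSubfield L))) (w : PlacesOver L v) (e x₁ x₂ x₃ : LocalRing L v) :
    (!![e * (x₁ + x₃), 0, -(e * (x₁ - x₃)); 0, x₂, 0; -(e * (x₁ - x₃)), 0, e * (x₁ + x₃)] :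
        Matrix (Fin 3) (Fin 3) (LocalRing L v)).map (Pi.evalRingHom (fun w' : PlacesOver L v => w'.1.adicCompletion L) w) =
      !![e w * (x₁ w + x₃ w), 0, -(e w * (x₁ w - x₃ w)); 0, x₂ w, 0; -(e w * (x₁ w - x₃ w)), 0, e w * (x₁ w + x₃ w)] :=
  Matrix.ext fun a b => by fin_cases a <;> fin_cases b <;> rfl

set_option maxHeartbeats 400000 in
/-- **The transported representative.** At an inert `w ∣ v`: if `τ = T_l t T_l⁻¹ ∈ U(Φ₃)(L⁺_v)` has `w`-component `M` with `M ≡ 1 (mod ϖ²)`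
entrywise (`|ϖ²| ≤ 1`), and `(T_l)_w⁻¹ = u · k` with `u ∈ U(H′_w)`, `k ∈ GL₃(𝒪_w)` (★ L1 `exists_mem_unitaryGroupOfForm_mul_of_selfDual_of_nonsplit`),
then `γ₀ := s⁻¹ t s`, `s := e_H⁻¹(u)` (`e_H` the one-place model ★ `localNonsplitEquiv`) is conjugate to `t`, lies in `K = U(H′)(𝒪_v)` and
`e_H(γ₀) = k M k⁻¹ ≡ 1 (mod ϖ²)`. [cite: Rogawski1990, §4.9 p. 54; §12.2 p. 174] [cite: Jacobowitz1962, §7 Thm. 7.1] -/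
theorem exists_conj_mem_localIntegralLevel_of_literal (L : Type) [Field L] [NumberField L] [IsCMField L] (H' : Matrix (Fin 3) (Fin 3) L) {v : HeightOneSpectrum (𝓞 ↥(maximalRealSubfield L))}
    (w : PlacesOver L v) (hw : IsCMField.complexConj L • w.1 = w.1)
    (t : ↥(UnitaryGroup.«local» L (IsCMField.complexConj L) 3 H' v)) (Tl : GL (Fin 3) (LocalRing L v))
    (τ : ↥(UnitaryGroup.«local» L (IsCMField.complexConj L) 3 (Matrix.of fun i j : Fin 3 => if i.val + j.val + 1 = 3 then (1 : L) else 0) v))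
    (hτ : τ.val = Tl * t.val * Tl⁻¹) (k uu : GL (Fin 3) (w.1.adicCompletion L)) (hk : k ∈ glInt 3 (w.1.adicCompletion L))
    (huu : uu ∈ unitaryGroupOfForm (galAdicCompletionMap (L := L) (IsCMField.complexConj L) hw) (placeForm H' w.1))
    (huk : (localGLPiEquiv L 3 v Tl w)⁻¹ = uu * k) (M : Matrix (Fin 3) (Fin 3) (w.1.adicCompletion L))
    (hM : (((τ.val : GL (Fin 3) (LocalRing L v)) : Matrix (Fin 3) (Fin 3) (LocalRing L v)).map
      (Pi.evalRingHom (fun w' : PlacesOver L v => w'.1.adicCompletion L) w) = M))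
    (ϖ2 : w.1.adicCompletion L) (hϖ2 : 0 < Valued.v ϖ2) (hϖ21 : Valued.v ϖ2 ≤ 1) (hMD : ∀ a b, Valued.v ((M - 1) a b) ≤ Valued.v ϖ2) :
    ∃ γ₀ : ↥(UnitaryGroup.«local» L (IsCMField.complexConj L) 3 H' v), ConjClasses.mk γ₀ = ConjClasses.mk t ∧
      γ₀ ∈ localIntegralLevel (IsCMField.complexConj L) 3 H' v ∧
      ∀ a b, Valued.v (ϖ2⁻¹ * ((((localNonsplitEquiv (IsCMField.complexConj L) H' (IsCMField.complexConj_ne_one L) w hw γ₀ :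
        ↥(unitaryGroupOfForm (galAdicCompletionMap (L := L) (IsCMField.complexConj L) hw) (placeForm H' w.1))) :
          GL (Fin 3) (w.1.adicCompletion L)) : Matrix (Fin 3) (Fin 3) (w.1.adicCompletion L)) a b -
          (1 : Matrix (Fin 3) (Fin 3) (w.1.adicCompletion L)) a b)) ≤ 1 := by
  classical
  set Tlw : GL (Fin 3) (w.1.adicCompletion L) := localGLPiEquiv L 3 v Tl w with hTlw
  set eH := localNonsplitEquiv (IsCMField.complexConj L) H' (IsCMField.complexConj_ne_one L) w hw with heH
  have hTlw_val : ∀ X : GL (Fin 3) (LocalRing L v), ((localGLPiEquiv L 3 v X w : GL (Fin 3) (w.1.adicCompletion L)) :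
      Matrix (Fin 3) (Fin 3) (w.1.adicCompletion L)) =
      (X : Matrix (Fin 3) (Fin 3) (LocalRing L v)).map (Pi.evalRingHom (fun w' : PlacesOver L v => w'.1.adicCompletion L) w) := by
    intro X; exact Matrix.ext fun i j => by rw [localGLPiEquiv_apply_apply, Matrix.map_apply]; rfl
  have hTlw_inv : Tlw⁻¹ = localGLPiEquiv L 3 v Tl⁻¹ w := by rw [hTlw, map_inv, Pi.inv_apply]
  have hTlw' : Tlw = k⁻¹ * uu⁻¹ := by rw [← _root_.mul_inv_rev, ← huk, inv_inv]
  have hk1 := ((Literature.NumberTheory.Automorphic.HermitianLatticeTree.mem_glInt_iff_forall_v_le_one_and_v_det_eq_one k).1 hk).1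
  have hki1 := ((Literature.NumberTheory.Automorphic.HermitianLatticeTree.mem_glInt_iff_forall_v_le_one_and_v_det_eq_one k⁻¹).1 (inv_mem hk)).1
  have hΦunit : IsUnit (placeForm (Matrix.of fun i j : Fin 3 => if i.val + j.val + 1 = 3 then (1 : L) else 0) w.1).det :=
    (Matrix.isUnit_iff_isUnit_det _).1 (isUnit_placeForm_antidiagOne (E := L) (N := 3) w.1)
  set τw : GL (Fin 3) (w.1.adicCompletion L) := ((localNonsplitEquiv (IsCMField.complexConj L)
    (Matrix.of fun i j : Fin 3 => if i.val + j.val + 1 = 3 then (1 : L) else 0) (IsCMField.complexConj_ne_one L) w hw τ :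
      ↥(unitaryGroupOfForm (galAdicCompletionMap (L := L) (IsCMField.complexConj L) hw)
        (placeForm (Matrix.of fun i j : Fin 3 => if i.val + j.val + 1 = 3 then (1 : L) else 0) w.1))) :
          GL (Fin 3) (w.1.adicCompletion L)) with hτw
  have hτM : (τw : Matrix (Fin 3) (Fin 3) (w.1.adicCompletion L)) = M := by rw [← hM]; rfl
  have hτdet : Valued.v (τw : Matrix (Fin 3) (Fin 3) (w.1.adicCompletion L)).det = 1 :=
    Literature.NumberTheory.Automorphic.UnitaryLatticeTree.v_det_eq_one_of_mem_unitary
      (galAdicCompletionMap (L := L) (IsCMField.complexConj L) hw) (fun x => valued_galAdicCompletionMap L (IsCMField.complexConj L) hw x)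
      (localNonsplitEquiv (IsCMField.complexConj L) (Matrix.of fun i j : Fin 3 => if i.val + j.val + 1 = 3 then (1 : L) else 0)
        (IsCMField.complexConj_ne_one L) w hw τ).2 hΦunit
  have hMint : ∀ a b, Valued.v (M a b) ≤ 1 := by
    intro a b
    have h := Valuation.map_add Valued.v ((M - 1) a b) ((1 : Matrix (Fin 3) (Fin 3) (w.1.adicCompletion L)) a b)
    rw [Matrix.sub_apply, sub_add_cancel] at h
    refine h.trans (max_le ((hMD a b).trans hϖ21) ?_)
    rw [Matrix.one_apply]; split_ifs <;> simp
  have hτint : τw ∈ glInt 3 (w.1.adicCompletion L) :=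
    (Literature.NumberTheory.Automorphic.HermitianLatticeTree.mem_glInt_iff_forall_v_le_one_and_v_det_eq_one τw).2
      ⟨fun a b => by rw [hτM]; exact hMint a b, hτdet⟩
  -- `e_H(t) = Tlw⁻¹ · τw · Tlw`
  have hconj : Tl⁻¹ * τ.val * Tl = t.val := by rw [hτ]; group
  have het : ((eH t : ↥(unitaryGroupOfForm (galAdicCompletionMap (L := L) (IsCMField.complexConj L) hw) (placeForm H' w.1))) :
      GL (Fin 3) (w.1.adicCompletion L)) = Tlw⁻¹ * τw * Tlw := by
    apply Units.ext
    rw [Units.val_mul, Units.val_mul, hTlw_inv, hTlw, hTlw_val, hTlw_val, hτw, heH]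
    simp only [coe_localNonsplitEquiv_apply]
    rw [← Matrix.map_mul, ← Matrix.map_mul, ← Units.val_mul, ← Units.val_mul, hconj]
  obtain ⟨s, hs⟩ : ∃ s : ↥(UnitaryGroup.«local» L (IsCMField.complexConj L) 3 H' v), s = eH.symm ⟨uu, huu⟩ := ⟨_, rfl⟩
  obtain ⟨γ₀, hγ₀⟩ : ∃ γ₀ : ↥(UnitaryGroup.«local» L (IsCMField.complexConj L) 3 H' v), γ₀ = s⁻¹ * t * s := ⟨_, rfl⟩
  have hes : ((eH s : ↥(unitaryGroupOfForm (galAdicCompletionMap (L := L) (IsCMField.complexConj L) hw) (placeForm H' w.1))) :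
      GL (Fin 3) (w.1.adicCompletion L)) = uu := by
    rw [hs, ContinuousMulEquiv.apply_symm_apply]
  have heγ : ((eH γ₀ : ↥(unitaryGroupOfForm (galAdicCompletionMap (L := L) (IsCMField.complexConj L) hw) (placeForm H' w.1))) :
      GL (Fin 3) (w.1.adicCompletion L)) = k * τw * k⁻¹ := by
    rw [hγ₀, map_mul, map_mul, map_inv, Subgroup.coe_mul, Subgroup.coe_mul, Subgroup.coe_inv, hes, het, hTlw', _root_.mul_inv_rev, inv_inv, inv_inv]
    group
  have hcj : ConjClasses.mk γ₀ = ConjClasses.mk t := ConjClasses.mk_eq_mk_iff_isConj.2 (isConj_iff.2 ⟨s, by rw [hγ₀]; group⟩)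
  refine ⟨γ₀, hcj, ?_, ?_⟩
  · refine (mem_localIntegralLevel_iff_of_smul_eq (IsCMField.complexConj L) 3 H' (IsCMField.complexConj_ne_one L) w hw γ₀).2 ?_
    rw [← heH, heγ]
    exact mul_mem (mul_mem hk hτint) (inv_mem hk)
  · intro a b
    rw [heγ, Units.val_mul, Units.val_mul]
    have hsub : (k : Matrix (Fin 3) (Fin 3) (w.1.adicCompletion L)) * (τw : Matrix (Fin 3) (Fin 3) (w.1.adicCompletion L)) *
        ((k⁻¹ : GL (Fin 3) (w.1.adicCompletion L)) : Matrix (Fin 3) (Fin 3) (w.1.adicCompletion L)) - 1 =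
        (k : Matrix (Fin 3) (Fin 3) (w.1.adicCompletion L)) * ((τw : Matrix (Fin 3) (Fin 3) (w.1.adicCompletion L)) - 1) *
        ((k⁻¹ : GL (Fin 3) (w.1.adicCompletion L)) : Matrix (Fin 3) (Fin 3) (w.1.adicCompletion L)) := by
      rw [Matrix.mul_sub, Matrix.sub_mul, Matrix.mul_one, Units.mul_inv]
    have hentry : Valued.v (((k : Matrix (Fin 3) (Fin 3) (w.1.adicCompletion L)) * (τw : Matrix (Fin 3) (Fin 3) (w.1.adicCompletion L)) *
        ((k⁻¹ : GL (Fin 3) (w.1.adicCompletion L)) : Matrix (Fin 3) (Fin 3) (w.1.adicCompletion L))) a b -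
        (1 : Matrix (Fin 3) (Fin 3) (w.1.adicCompletion L)) a b) ≤ Valued.v ϖ2 := by
      rw [← Matrix.sub_apply, hsub, Matrix.mul_apply]
      refine Valuation.map_sum_le _ fun c _ => ?_
      rw [map_mul, Matrix.mul_apply]
      refine (mul_le_mul' (Valuation.map_sum_le _ fun d _ => ?_) (hki1 c b)).trans_eq (mul_one _)
      rw [map_mul]
      refine (mul_le_mul' (hk1 a d) ?_).trans_eq (one_mul _)
      rw [Matrix.sub_apply, hτM]
      exact hMD d c
    rw [map_mul, map_inv₀]
    exact (inv_mul_le_iff₀ hϖ2).2 (by rw [mul_one]; exact hentry)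

set_option maxHeartbeats 800000 in
open scoped Classical in
/-- **The rider AT ONE MATCHED ELEMENT** (`γ_H ∈ K_H`, 3-deep eigen-data, `G`-regular, type (1), not of Levi type): every `Δ‴`-support class meeting `K` has a
`K`-representative `≡ 1 (mod ϖ_v²)` at `w`. [cite: Rogawski1990, §4.9 Prop. 4.9.1 (a) p. 55] [cite: Flicker1998UnitaryFL, §6 p. 97] [cite: Jacobowitz1962, §7 Thm. 7.1] -/
theorem twoDeepRep_typeOne_at
    (L : Type) [Field L] [NumberField L] [IsCMField L] (H' : Matrix (Fin 3) (Fin 3) L) (μ : HeckeCharacter L)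
    {v : HeightOneSpectrum (𝓞 ↥(maximalRealSubfield L))}
    (hH' : (H'.map (cmConjRingHom L)).transpose = H') (w : PlacesOver L v)
    (hw : IsCMField.complexConj L • w.1 = w.1) (hv : Algebra.IsUnramifiedIn (𝓞 L) v.asIdeal)
    (hH'w : IsUnit (placeForm H' w.1)) (hH'i : hH'w.unit ∈ glInt 3 (w.1.adicCompletion L))
    (h2 : IsUnit (2 : 𝒪[w.1.adicCompletion L]))
    (γH : ((cmDatum L 2 (Matrix.of fun i j : Fin 2 => if i.val + j.val + 1 = 2 then (1 : L) else 0)).Local v ×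
      (cmDatum L 1 (Matrix.of fun i j : Fin 1 => if i.val + j.val + 1 = 1 then (1 : L) else 0)).Local v))
    (hγK : γH ∈ ((cmLocalIntegralLevel L 2 (Matrix.of fun i j : Fin 2 => if i.val + j.val + 1 = 2 then (1 : L) else 0) v).prod
      (cmLocalIntegralLevel L 1 (Matrix.of fun i j : Fin 1 => if i.val + j.val + 1 = 1 then (1 : L) else 0) v)))
    (htr : Valued.v (((γH.1.val : GL (Fin 2) (UnitaryGroup.LocalRing L v)).val.map (Pi.evalRingHom (fun w' : PlacesOver L v => w'.1.adicCompletion L) w)).trace - 2) <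
      Valued.v ((toPlace v w (HeckeCharacter.uniformizer ↥(maximalRealSubfield L) v : v.adicCompletion ↥(maximalRealSubfield L))) ^ 6))
    (hdet : Valued.v (((γH.1.val : GL (Fin 2) (UnitaryGroup.LocalRing L v)).val.map (Pi.evalRingHom (fun w' : PlacesOver L v => w'.1.adicCompletion L) w)).det - 1) <
      Valued.v ((toPlace v w (HeckeCharacter.uniformizer ↥(maximalRealSubfield L) v : v.adicCompletion ↥(maximalRealSubfield L))) ^ 6))
    (hub : Valued.v (finGammaTwo L v γH w - 1) < Valued.v ((toPlace v w (HeckeCharacter.uniformizer ↥(maximalRealSubfield L) v : v.adicCompletion ↥(maximalRealSubfield L))) ^ 3))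
    (hreg : IsLocalGRegular L v γH)
    (hsplit : ∃ x : w.1.adicCompletion L, (((γH.1.val : GL (Fin 2) (UnitaryGroup.LocalRing L v)).val.map
          (Pi.evalRingHom (fun w' : PlacesOver L v => w'.1.adicCompletion L) w)).charpoly).IsRoot x)
    (hlev : ¬ (∃ (y : ((cmDatum L 2 (Matrix.of fun i j : Fin 2 => if i.val + j.val + 1 = 2 then (1 : L) else 0)).Local v ×
      (cmDatum L 1 (Matrix.of fun i j : Fin 1 => if i.val + j.val + 1 = 1 then (1 : L) else 0)).Local v)) (d' : Fin 2 → (UnitaryGroup.LocalRing L v)ˣ),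
          glDiagonal 2 (UnitaryGroup.LocalRing L v) d' = ((y * γH * y⁻¹).1.val : GL (Fin 2) (UnitaryGroup.LocalRing L v)))) :
      (∀ cG : ConjClasses ((cmDatum L 3 H').Local v),
          ((finExplicitCollection L H' μ (finExplicitDelta_conj_left_all L H' μ) (finExplicitDelta_conj_right_all L H' μ)) v).Δ γH (Quotient.out cG) ≠ 0 →
          (∃ z ∈ cmLocalIntegralLevel L 3 H' v, ConjClasses.mk z = cG) →
          ∃ γ₀ : ((cmDatum L 3 H').Local v), ConjClasses.mk γ₀ = cG ∧ γ₀ ∈ cmLocalIntegralLevel L 3 H' v ∧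
            (∀ a b, Valued.v (((toPlace v w (HeckeCharacter.uniformizer ↥(maximalRealSubfield L) v : v.adicCompletion ↥(maximalRealSubfield L))) ^ 2)⁻¹ *
        ((((localNonsplitEquiv (IsCMField.complexConj L) H' (IsCMField.complexConj_ne_one L) w hw (γ₀) :
            ↥(unitaryGroupOfForm (galAdicCompletionMap (L := L) (IsCMField.complexConj L) hw) (placeForm H' w.1))) : GL (Fin 3) (w.1.adicCompletion L)) :
              Matrix (Fin 3) (Fin 3) (w.1.adicCompletion L)) a b - (1 : Matrix (Fin 3) (Fin 3) (w.1.adicCompletion L)) a b)) ≤ 1)) := by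
  classical
  haveI := Literature.NumberTheory.Automorphic.isAdicComplete_maximalIdeal_valuedInteger_adicCompletion L w.1
  have hiso := ValuativeRel.isEquiv (ValuativeRel.valuation (w.1.adicCompletion L))
    (Valued.v : Valuation (w.1.adicCompletion L) (WithZero (Multiplicative ℤ)))
  have hc1 : IsCMField.complexConj L ≠ 1 := IsCMField.complexConj_ne_one L
  -- `H′` hermitian in the `IsCMField.complexConj` spelling, and invertible (its image at `w` is)
  have hH'c : (H'.map (IsCMField.complexConj L))ᵀ = H' := by
    have e1 : H'.map (cmConjRingHom L) = H'.map (IsCMField.complexConj L) := by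
      ext i j; simp [Matrix.map_apply, cmConjRingHom_apply]
    rw [← e1]; exact hH'
  have hH'u : IsUnit H' := by
    rw [Matrix.isUnit_iff_isUnit_det]
    have h := (Matrix.isUnit_iff_isUnit_det _).1 hH'w
    change IsUnit (H'.map (algebraMap L (w.1.adicCompletion L))).det at h
    rw [← RingHom.mapMatrix_apply, ← RingHom.map_det, isUnit_iff_ne_zero, _root_.map_ne_zero] at h
    exact isUnit_iff_ne_zero.2 h
  -- the uniformizer `ϖ_w = ι_w(ϖ_v)` and the weaker depth bounds used by the frames
  set ϖw : w.1.adicCompletion L := (toPlace v w (HeckeCharacter.uniformizer ↥(maximalRealSubfield L) v : v.adicCompletion ↥(maximalRealSubfield L))) with hϖw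
  have hϖ1 : Valued.v ϖw = WithZero.exp (-1 : ℤ) :=
    Literature.NumberTheory.Automorphic.Liu2021.LemD1IndexedNonVacuityInertCofinite.valued_toPlace_uniformizer_of_isUnramifiedIn L v hv w
  have hϖlt : Valued.v ϖw < 1 := by rw [hϖ1, ← WithZero.exp_zero]; exact WithZero.exp_lt_exp.2 (by norm_num)
  have hϖ0 : Valued.v ϖw ≠ 0 := by rw [hϖ1]; exact WithZero.exp_ne_zero
  have hϖpow : ∀ m : ℕ, Valued.v (ϖw ^ m) ≤ 1 := fun m => by rw [map_pow]; exact pow_le_one₀ zero_le hϖlt.le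
  have hlt1 : ∀ {s : w.1.adicCompletion L} {m : ℕ}, Valued.v s < Valued.v (ϖw ^ m) → Valued.v s < 1 := fun {s} {m} hs => lt_of_lt_of_le hs (hϖpow m)
  have htr1' : Valued.v (((γH.1.val : GL (Fin 2) (UnitaryGroup.LocalRing L v)).val.map (Pi.evalRingHom (fun w' : PlacesOver L v => w'.1.adicCompletion L) w)).trace - 2) < 1 :=
    hlt1 htr
  have hdet1' : Valued.v (((γH.1.val : GL (Fin 2) (UnitaryGroup.LocalRing L v)).val.map (Pi.evalRingHom (fun w' : PlacesOver L v => w'.1.adicCompletion L) w)).det - 1) < 1 :=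
    hlt1 hdet
  have hub1 : Valued.v (finGammaTwo L v γH w - 1) < 1 := hlt1 hub
  have hvs : Subsingleton (PlacesOver L v) :=
    PlacesOver.subsingleton_of_smul_eq (IsCMField.complexConj L) (IsCMField.complexConj_ne_one L) w hw
  -- §2 INTEGRALITY of `χ_{ι(γ_H),w}` (from `γ_H ∈ K_H`) and the split eigen-data `α ≠ γ`, `N₁, N₂, N`
  have hιK := (endoEmbLocal_mem_cmLocalIntegralLevel_iff L v γH).2 hγK
  have hKw := ((mem_localIntegralLevel_iff (IsCMField.complexConj L) 3 _ v (endoEmbLocal L v γH)).1 hιK) w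
  have hmat : ((localGLPiEquiv L 3 v ((endoEmbLocal L v γH).val : GL (Fin 3) (UnitaryGroup.LocalRing L v)) w : GL (Fin 3) (w.1.adicCompletion L)) :
      Matrix (Fin 3) (Fin 3) (w.1.adicCompletion L)) =
      ((endoEmbLocal L v γH).val : GL (Fin 3) (UnitaryGroup.LocalRing L v)).val.map (Pi.evalRingHom (fun w' : PlacesOver L v => w'.1.adicCompletion L) w) := by
    ext i j; rw [localGLPiEquiv_apply_apply, Matrix.map_apply]; rfl
  have hint : ∀ i : ℕ, ((((endoEmbLocal L v γH).val : GL (Fin 3) (LocalRing L v)).val.map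
      (Pi.evalRingHom (fun w' : PlacesOver L v => w'.1.adicCompletion L) w)).charpoly.coeff i) ∈ 𝒪[w.1.adicCompletion L] := by
    intro i
    have h := coeff_charpoly_mem_integer_of_mem_glInt hKw i
    rwa [hmat] at h
  have hintV : ∀ i : ℕ, ((((endoEmbLocal L v γH).val : GL (Fin 3) (UnitaryGroup.LocalRing L v)).val.map
      (Pi.evalRingHom (fun w' : PlacesOver L v => w'.1.adicCompletion L) w)).charpoly.coeff i) ∈ Valued.integer (w.1.adicCompletion L) :=
    fun i => (Valuation.mem_integer_iff _ _).2 ((hiso.le_one_iff_le_one).1 ((Valuation.mem_integer_iff _ _).1 (hint i)))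
  obtain ⟨α, γ, N₁, N₂, N, hα, hγ, hαγ, hN₁, hN₂, hN, htri⟩ := exists_flicker_exponents_split L v w hw hreg hintV hsplit
  -- §3 DEEPNESS: `α, γ, u_w ≡ 1 (mod 𝔪_w)` (from `tr g_w ≡ 2`, `det g_w ≡ 1`), hence `1 ≤ N₁, N₂, N`
  have hcm : ((((γH.1.val : GL (Fin 2) (LocalRing L v)) : Matrix (Fin 2) (Fin 2) (LocalRing L v)).charpoly).map
      (Pi.evalRingHom (fun w' : PlacesOver L v => w'.1.adicCompletion L) w)) =
      X ^ 2 - C ((γH.1.val : GL (Fin 2) (UnitaryGroup.LocalRing L v)).val.map (Pi.evalRingHom (fun w' : PlacesOver L v => w'.1.adicCompletion L) w)).trace * X +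
        C ((γH.1.val : GL (Fin 2) (UnitaryGroup.LocalRing L v)).val.map (Pi.evalRingHom (fun w' : PlacesOver L v => w'.1.adicCompletion L) w)).det := by
    rw [← Matrix.charpoly_map, Matrix.charpoly_fin_two]
  have hv2 : Valued.v (2 : w.1.adicCompletion L) ≤ 1 := by
    rw [← one_add_one_eq_two]; exact (Valuation.map_add _ _ _).trans (max_le (le_of_eq (map_one _)) (le_of_eq (map_one _)))
  have htr1 : Valued.v ((γH.1.val : GL (Fin 2) (UnitaryGroup.LocalRing L v)).val.map (Pi.evalRingHom (fun w' : PlacesOver L v => w'.1.adicCompletion L) w)).trace ≤ 1 := by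
    have h := Valuation.map_add Valued.v (((γH.1.val : GL (Fin 2) (UnitaryGroup.LocalRing L v)).val.map (Pi.evalRingHom (fun w' : PlacesOver L v => w'.1.adicCompletion L) w)).trace - 2) 2
    rw [sub_add_cancel] at h
    exact h.trans (max_le htr1'.le hv2)
  have hdet1 : Valued.v ((γH.1.val : GL (Fin 2) (UnitaryGroup.LocalRing L v)).val.map (Pi.evalRingHom (fun w' : PlacesOver L v => w'.1.adicCompletion L) w)).det ≤ 1 := by
    have h := Valuation.map_add Valued.v (((γH.1.val : GL (Fin 2) (UnitaryGroup.LocalRing L v)).val.map (Pi.evalRingHom (fun w' : PlacesOver L v => w'.1.adicCompletion L) w)).det - 1) 1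
    rw [sub_add_cancel] at h
    exact h.trans (max_le hdet1'.le (le_of_eq (map_one _)))
  have hdeep : ∀ z : w.1.adicCompletion L, ((((γH.1.val : GL (Fin 2) (LocalRing L v)) : Matrix (Fin 2) (Fin 2) (LocalRing L v)).charpoly).map
      (Pi.evalRingHom (fun w' : PlacesOver L v => w'.1.adicCompletion L) w)).IsRoot z → Valued.v (z - 1) < 1 := by
    intro z hz
    rw [hcm] at hz
    set T := ((γH.1.val : GL (Fin 2) (UnitaryGroup.LocalRing L v)).val.map (Pi.evalRingHom (fun w' : PlacesOver L v => w'.1.adicCompletion L) w)).trace with hT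
    set D := ((γH.1.val : GL (Fin 2) (UnitaryGroup.LocalRing L v)).val.map (Pi.evalRingHom (fun w' : PlacesOver L v => w'.1.adicCompletion L) w)).det with hD
    have hz0 : z ^ 2 - T * z + D = 0 := by
      have h := hz
      simp only [Polynomial.IsRoot, eval_add, eval_sub, eval_mul, eval_pow, eval_X, eval_C] at h
      exact h
    -- `|z| ≤ 1`: a root of a monic integral quadratic
    have hz1 : Valued.v z ≤ 1 := by
      by_contra hlt
      push Not at hlt
      have hzz : Valued.v (z ^ 2) = Valued.v z * Valued.v z := by rw [pow_two, map_mul]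
      have h1 : Valued.v (T * z) < Valued.v (z ^ 2) := by
        rw [hzz, map_mul]
        exact mul_lt_mul_of_lt_of_le_of_nonneg_of_pos (lt_of_le_of_lt htr1 hlt) le_rfl zero_le (lt_trans zero_lt_one hlt) |>.trans_le le_rfl
      have h2 : Valued.v D < Valued.v (z ^ 2) := by
        rw [hzz]
        calc Valued.v D ≤ 1 := hdet1
          _ = 1 * 1 := (mul_one 1).symm
          _ < Valued.v z * Valued.v z := mul_lt_mul'' hlt hlt zero_le zero_le
      have h3 : Valued.v (z ^ 2 - T * z + D) = Valued.v (z ^ 2) := by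
        rw [Valuation.map_add_eq_of_lt_left _ (by rw [Valuation.map_sub_eq_of_lt_left _ h1]; exact h2), Valuation.map_sub_eq_of_lt_left _ h1]
      rw [hz0, map_zero] at h3
      exact (pow_ne_zero 2 (ne_of_gt (lt_trans zero_lt_one hlt)) : Valued.v z ^ 2 ≠ 0) (by rw [← map_pow]; exact h3.symm)
    have hsq : (z - 1) ^ 2 = (T - 2) * z - (D - 1) := by linear_combination hz0
    have hlt : Valued.v ((z - 1) ^ 2) < 1 := by
      rw [hsq]
      refine lt_of_le_of_lt (Valuation.map_sub _ _ _) (max_lt ?_ hdet1')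
      rw [map_mul]
      exact mul_lt_one_of_nonneg_of_lt_one_left zero_le htr1' hz1
    by_contra hge
    push Not at hge
    rw [map_pow] at hlt
    exact absurd hlt (not_lt.2 (one_le_pow₀ hge))
  have hα1 : Valued.v (α - 1) < 1 := hdeep α hα
  have hγ1 : Valued.v (γ - 1) < 1 := hdeep γ hγ
  have hdeep3 : ∀ z : w.1.adicCompletion L, ((((γH.1.val : GL (Fin 2) (LocalRing L v)) : Matrix (Fin 2) (Fin 2) (LocalRing L v)).charpoly).map
      (Pi.evalRingHom (fun w' : PlacesOver L v => w'.1.adicCompletion L) w)).IsRoot z → Valued.v (z - 1) < Valued.v (ϖw ^ 3) := by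
    intro z hz
    have hz1' := hdeep z hz
    rw [hcm] at hz
    set T := ((γH.1.val : GL (Fin 2) (UnitaryGroup.LocalRing L v)).val.map (Pi.evalRingHom (fun w' : PlacesOver L v => w'.1.adicCompletion L) w)).trace with hT
    set D := ((γH.1.val : GL (Fin 2) (UnitaryGroup.LocalRing L v)).val.map (Pi.evalRingHom (fun w' : PlacesOver L v => w'.1.adicCompletion L) w)).det with hD
    have hz0 : z ^ 2 - T * z + D = 0 := by
      have h := hz
      simp only [Polynomial.IsRoot, eval_add, eval_sub, eval_mul, eval_pow, eval_X, eval_C] at h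
      exact h
    have hzle : Valued.v z ≤ 1 := by
      have h := Valuation.map_add Valued.v (z - 1) 1
      rw [sub_add_cancel] at h
      exact h.trans (max_le hz1'.le (le_of_eq (map_one _)))
    have hsq : (z - 1) ^ 2 = (T - 2) * z - (D - 1) := by linear_combination hz0
    have hlt : Valued.v ((z - 1) ^ 2) < Valued.v (ϖw ^ 6) := by
      rw [hsq]
      refine lt_of_le_of_lt (Valuation.map_sub _ _ _) (max_lt ?_ hdet)
      rw [map_mul]
      exact lt_of_le_of_lt (mul_le_of_le_one_right zero_le hzle) htr
    rw [map_pow, show ϖw ^ 6 = (ϖw ^ 3) ^ 2 by ring, map_pow (Valued.v) (ϖw ^ 3) 2] at hlt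
    exact lt_of_pow_lt_pow_left₀ 2 zero_le hlt
  have hα3 : Valued.v (α - 1) < Valued.v (ϖw ^ 3) := hdeep3 α hα
  have hγ3 : Valued.v (γ - 1) < Valued.v (ϖw ^ 3) := hdeep3 γ hγ
  have hsub1 : ∀ {s t : w.1.adicCompletion L}, Valued.v (s - 1) < 1 → Valued.v (t - 1) < 1 → Valued.v (s - t) < 1 := by
    intro s t hs ht
    have h := Valuation.map_sub Valued.v (s - 1) (t - 1)
    rw [sub_sub_sub_cancel_right] at h
    exact lt_of_le_of_lt h (max_lt hs ht)
  have hexp1 : ∀ {M : ℕ} {s : w.1.adicCompletion L}, Valued.v s = WithZero.exp (-(M : ℤ)) → Valued.v s < 1 → 1 ≤ M := by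
    intro M s hs hlt
    rw [hs, ← WithZero.exp_zero, WithZero.exp_lt_exp] at hlt
    omega
  have h₁ : 1 ≤ N₁ := hexp1 hN₁ (hsub1 hα1 hub1)
  have h₂ : 1 ≤ N₂ := hexp1 hN₂ (hsub1 hγ1 hub1)
  have hN1 : 1 ≤ N := hexp1 hN (hsub1 hα1 hγ1)
  -- §4 FLICKER'S SCALARS, AN EIGENFRAME OF `g`, THE FOUR MATCHED REPRESENTATIVES (★ N7 lineage)
  have h2w : Valued.v (2 : w.1.adicCompletion L) = 1 := (isUnit_two_integer_iff_valued_eq_one L w.1).1 h2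
  have h2L : (2 : 𝓞 L) ∉ w.1.asIdeal := by
    have e1 : (algebraMap L (w.1.adicCompletion L)) (algebraMap (𝓞 L) L 2) = 2 := by rw [map_ofNat, map_ofNat]
    have h2w' := h2w
    rw [← e1] at h2w'
    change Valued.v ((algebraMap (𝓞 L) L 2 : L) : w.1.adicCompletion L) = 1 at h2w'
    rw [HeightOneSpectrum.valuedAdicCompletion_eq_valuation', HeightOneSpectrum.valuation_of_algebraMap] at h2w'
    exact HeightOneSpectrum.intValuation_eq_one_iff.1 h2w'
  have h2F : (2 : 𝓞 ↥(maximalRealSubfield L)) ∉ v.asIdeal := by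
    intro hmem
    apply h2L
    have h := congrArg HeightOneSpectrum.asIdeal w.2
    rw [← h] at hmem
    simp only [HeightOneSpectrum.under_asIdeal, Ideal.under_def, Ideal.mem_comap, map_ofNat] at hmem
    exact hmem
  have h2v : Valued.v (2 : v.adicCompletion ↥(maximalRealSubfield L)) = 1 := valued_two_adicCompletion_eq_one v h2F
  have hsc := exists_flicker_scalars_of_nonsplit L v w hw hv h2v
  obtain ⟨e, -, x, y, h2e, -, -, -, hx, hy⟩ := hsc
  -- Flicker's non-norm `π` := the uniformizer `ι_v(ϖ_v)` (σ-fixed; not a norm: norms have EVEN valuation at the inert `w`)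
  set π : LocalRing L v := toLocalRing L v (HeckeCharacter.uniformizer ↥(maximalRealSubfield L) v : v.adicCompletion ↥(maximalRealSubfield L)) with hπdef
  have hπu : IsUnit π := isUnit_toLocalRing_uniformizer L v
  have hσπ : conjLocal L (IsCMField.complexConj L) v π = π := by rw [hπdef, conjLocal_toLocalRing]
  have hπw : π w = ϖw := by rw [hπdef, toLocalRing_apply]
  have hσw : ∀ z : LocalRing L v, conjLocal L (IsCMField.complexConj L) v z w = galAdicCompletionMap (L := L) (IsCMField.complexConj L) hw (z w) :=
    fun z => conjLocal_apply_eq_of_smul_eq (IsCMField.complexConj L) hc1 v w hw z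
  have hπN : ∀ z : LocalRing L v, conjLocal L (IsCMField.complexConj L) v z * z ≠ π := by
    intro z hz
    have hzw := congrFun hz w
    rw [Pi.mul_apply, hσw, hπw] at hzw
    have hv := congrArg Valued.v hzw
    rw [map_mul, valued_galAdicCompletionMap, hϖ1] at hv
    rcases eq_or_ne (Valued.v (z w)) 0 with h0 | h0
    · rw [h0, mul_zero] at hv; exact WithZero.exp_ne_zero hv.symm
    · have hk : (WithZero.exp (Multiplicative.toAdd (WithZero.unzero h0)) : WithZero (Multiplicative ℤ)) = Valued.v (z w) := WithZero.coe_unzero h0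
      rw [← hk, ← WithZero.exp_add, WithZero.exp_inj] at hv
      omega
  have hππ : π * (hπu.unit⁻¹ : (LocalRing L v)ˣ) = 1 := hπu.mul_val_inv
  have hπ'w : ((hπu.unit⁻¹ : (LocalRing L v)ˣ) : LocalRing L v) w = ϖw⁻¹ := by
    have h := congrFun hππ w
    rw [Pi.mul_apply, hπw, Pi.one_apply] at h
    exact (eq_inv_of_mul_eq_one_right h)
  have hsep := (isRegularElt_fst_snd_of_isLocalGRegular L v γH hreg).1
  rw [isRegularElt_iff] at hsep
  have hEF := exists_eigenframe_cmDatum_local_of_isRoot_map_of_separable L v w hw γH.1 hα hsep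
  obtain ⟨P₂, u, hP₂, hu, hu0⟩ := hEF
  have hu1w : u 1 w = γ := by
    rcases eq_or_eq_eval_of_isRoot_of_eigenframe L v w hP₂ hγ with h | h
    · exact absurd (h.trans hu0) (Ne.symm hαγ)
    · exact h.symm
  have hu1 : ∀ i, conjLocal L (IsCMField.complexConj L) v (u i) * u i = 1 :=
    forall_conjLocal_mul_eq_one_of_not_exists_conj_glDiagonal L v w hw hP₂ hu hlev
  have hb1 := conjLocal_finGammaTwo_mul_finGammaTwo L v γH
  have hP₂' : (γH.1.val.val : Matrix (Fin 2) (Fin 2) (LocalRing L v)) * P₂.val = P₂.val * diagonal ![u 0, u 1] := by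
    rw [hP₂]; congr 1; ext i j; fin_cases i <;> fin_cases j <;> rfl
  have hαb : α ≠ finGammaTwo L v γH w := fun h0 => by
    rw [h0, sub_self, map_zero] at hN₁; exact WithZero.zero_ne_coe hN₁
  have hγb : γ ≠ finGammaTwo L v γH w := fun h0 => by
    rw [h0, sub_self, map_zero] at hN₂; exact WithZero.zero_ne_coe hN₂
  have had : u 0 ≠ u 1 := fun h => zero_ne_one (hu h)
  have hab : u 0 ≠ finGammaTwo L v γH := fun h => hαb (by rw [← hu0, h])
  have hbd : finGammaTwo L v γH ≠ u 1 := fun h => hγb (by rw [← hu1w, ← h])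
  -- deepness and the exponents, read on the eigenvalues `a = u 0`, `b = u`, `d = u 1`
  have hda : Valued.v (u 0 w - 1) < 1 := by rw [hu0]; exact hα1
  have hdd : Valued.v (u 1 w - 1) < 1 := by rw [hu1w]; exact hγ1
  have hvad : Valued.v (u 0 w - u 1 w) = WithZero.exp (-(N : ℤ)) := by rw [hu0, hu1w]; exact hN
  have hvda : Valued.v (u 1 w - u 0 w) = WithZero.exp (-(N : ℤ)) := by rw [Valuation.map_sub_swap, hvad]
  have hvab : Valued.v (u 0 w - finGammaTwo L v γH w) = WithZero.exp (-(N₁ : ℤ)) := by rw [hu0]; exact hN₁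
  have hvba : Valued.v (finGammaTwo L v γH w - u 0 w) = WithZero.exp (-(N₁ : ℤ)) := by rw [Valuation.map_sub_swap, hvab]
  have hvdb : Valued.v (u 1 w - finGammaTwo L v γH w) = WithZero.exp (-(N₂ : ℤ)) := by rw [hu1w]; exact hN₂
  have hvbd : Valued.v (finGammaTwo L v γH w - u 1 w) = WithZero.exp (-(N₂ : ℤ)) := by rw [Valuation.map_sub_swap, hvdb]
  -- the four matched representatives `t₁ … t₄` under ONE level-preserving congruence `ψ` (★ F0P3-p02)
  have hREP := exists_four_matched_flicker_representatives L H' hH'c w hw hv hH'w hH'i (γH := γH) h2e hσπ hππ hπN hx hy (hu1 0) (hu1 1) hP₂' had hab hbd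
  obtain ⟨Tl, ψ, t₁, t₂, t₃, t₄, τ₁, τ₂, τ₃, τ₄, P, P₁, dπ, g₃, g₄, hform, hψ, -, hlevψ, hn₁, hn₂, hn₃, hn₄, hP, hu', hu'1, hPP₁, hP₁,
    hψ₁, hψ₂, hψ₃, hψ₄, hτ₁, hτ₂c, hτ₃c, hτ₄c, hdπ, hg₃, hg₄, hτ₂, hτ₃, hτ₄, n12, n34⟩ := hREP
  have hlit₁ : (ψ t₁).val.val = !![e * (u 0 + u 1), 0, -(e * (u 0 - u 1)); 0, finGammaTwo L v γH, 0; -(e * (u 0 - u 1)), 0, e * (u 0 + u 1)] := by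
    rw [hψ₁, hτ₁]
  have hlit₂ : (ψ t₂).val.val =
      !![e * (u 0 + u 1), 0, -(e * (u 0 - u 1) * π); 0, finGammaTwo L v γH, 0; -(e * (u 0 - u 1) * ↑(hπu.unit⁻¹)), 0, e * (u 0 + u 1)] := by
    rw [hψ₂, hτ₂]
  have hlit₃ : (ψ t₃).val.val =
      !![e * (u 0 + finGammaTwo L v γH), 0, -(e * (u 0 - finGammaTwo L v γH) * π); 0, u 1, 0;
        -(e * (u 0 - finGammaTwo L v γH) * ↑(hπu.unit⁻¹)), 0, e * (u 0 + finGammaTwo L v γH)] := by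
    rw [hψ₃, hτ₃]
  have hlit₄ : (ψ t₄).val.val =
      !![e * (finGammaTwo L v γH + u 1), 0, -(e * (finGammaTwo L v γH - u 1) * π); 0, u 0, 0;
        -(e * (finGammaTwo L v γH - u 1) * ↑(hπu.unit⁻¹)), 0, e * (finGammaTwo L v γH + u 1)] := by
    rw [hψ₄, hτ₄]
  have hda3 : Valued.v (u 0 w - 1) < Valued.v (ϖw ^ 3) := by rw [hu0]; exact hα3
  have hdd3 : Valued.v (u 1 w - 1) < Valued.v (ϖw ^ 3) := by rw [hu1w]; exact hγ3
  -- §5 THE SUPPORT IS THE FOUR MATCHED CLASSES (★ organ)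
  have hα' : ((finCharpolyTwo L v γH).map (Pi.evalRingHom (fun w' : PlacesOver L v => w'.1.adicCompletion L) w)).IsRoot α := hα
  have hγ' : ((finCharpolyTwo L v γH).map (Pi.evalRingHom (fun w' : PlacesOver L v => w'.1.adicCompletion L) w)).IsRoot γ := hγ
  have hχu : IsUnit ((finCharpolyTwo L v γH).eval (finGammaTwo L v γH)) := isUnit_eval_finCharpolyTwo_of_isRoot L v w γH hvs hα' hγ' hαγ hαb hγb
  have hHf := map_conjLocal_transpose_localForm L 3 H' v hH'
  have hHd := isUnit_det_localForm L 3 H' v (Matrix.isUnit_iff_isUnit_det _ |>.1 hH'u).ne_zero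
  have himg : ∀ {t : (cmDatum L 3 H').Local v} {τ : ↥(UnitaryGroup.«local» L (IsCMField.complexConj L) 3
      (Matrix.of fun i j : Fin 3 => if i.val + j.val + 1 = 3 then (1 : L) else 0) v)}, ψ t = τ → Tl * t.val * Tl⁻¹ = τ.val := by
    intro t τ h
    rw [← hψ t, h]
  have hκ := finKappaAt_flicker_representatives_eq L v H' γH w hw hχu hHf hHd h2e hσπ hπN hx hy hform hn₁ hn₃ hn₄ hP hu' hu'1 hPP₁ hP₁
    hdπ hg₃ hg₄ (by rw [himg hψ₂, himg hψ₁, hτ₂c]) (by rw [himg hψ₃, himg hψ₁, hτ₃c]) (by rw [himg hψ₄, himg hψ₁, hτ₄c])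
  obtain ⟨hκ₁, hκ₂, hκ₃, hκ₄⟩ := hκ
  -- §6 THE TRANSPORT: `Tl_w⁻¹ = u · k` with `u ∈ U(H′_w)`, `k ∈ GL₃(𝒪_w)` (★ L1 at the inert place)
  set Tlw : GL (Fin 3) (w.1.adicCompletion L) := localGLPiEquiv L 3 v Tl w with hTlw
  set eH := localNonsplitEquiv (IsCMField.complexConj L) H' (IsCMField.complexConj_ne_one L) w hw with heH
  have hmapw : ∀ M : Matrix (Fin 3) (Fin 3) (LocalRing L v), (M.map (conjLocal L (IsCMField.complexConj L) v)).map
      (Pi.evalRingHom (fun w' : PlacesOver L v => w'.1.adicCompletion L) w) =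
      (M.map (Pi.evalRingHom (fun w' : PlacesOver L v => w'.1.adicCompletion L) w)).map
        (galAdicCompletionMap (L := L) (IsCMField.complexConj L) hw : w.1.adicCompletion L → w.1.adicCompletion L) := by
    intro M; exact Matrix.ext fun i j => by simp only [Matrix.map_apply]; exact hσw (M i j)
  have hTlw_val : ∀ X : GL (Fin 3) (LocalRing L v), ((localGLPiEquiv L 3 v X w : GL (Fin 3) (w.1.adicCompletion L)) :
      Matrix (Fin 3) (Fin 3) (w.1.adicCompletion L)) =
      (X : Matrix (Fin 3) (Fin 3) (LocalRing L v)).map (Pi.evalRingHom (fun w' : PlacesOver L v => w'.1.adicCompletion L) w) := by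
    intro X; exact Matrix.ext fun i j => by rw [localGLPiEquiv_apply_apply, Matrix.map_apply]; rfl
  have hTlw_inv : Tlw⁻¹ = localGLPiEquiv L 3 v Tl⁻¹ w := by rw [hTlw, map_inv, Pi.inv_apply]
  have hH'Loc : ((adelicForm L 3 H').map (adeleToLocal L v)).map (Pi.evalRingHom (fun w' : PlacesOver L v => w'.1.adicCompletion L) w) =
      placeForm H' w.1 := localForm_map_eval L 3 H' v w
  have hΦLoc : (Matrix.of fun i j : Fin 3 => if i.val + j.val + 1 = 3 then (1 : LocalRing L v) else 0).map
      (Pi.evalRingHom (fun w' : PlacesOver L v => w'.1.adicCompletion L) w) = (StdForm.antidiagonal 3).over (w.1.adicCompletion L) := by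
    rw [← antidiagOne_eq_over (w.1.adicCompletion L) 3]
    exact Matrix.ext fun i j => by simp only [Matrix.map_apply, Matrix.of_apply]; split_ifs <;> simp
  have hΦw : IsUnit (placeForm ((StdForm.antidiagonal 3).over L) w.1) := by
    rw [placeForm_antidiagonal]; exact StdForm.isUnit_over _ _
  -- `hform` read at `w`: `formCongr σ_w Tlw⁻¹ (H′_w) = Φ₃,w ∈ GL₃(𝒪_w)`
  have hgram : ∃ J' ∈ glInt 3 (w.1.adicCompletion L), (J' : Matrix (Fin 3) (Fin 3) (w.1.adicCompletion L)) =
      formCongr (galAdicCompletionMap (L := L) (IsCMField.complexConj L) hw) Tlw⁻¹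
        ((hH'w.unit : GL (Fin 3) (w.1.adicCompletion L)) : Matrix (Fin 3) (Fin 3) (w.1.adicCompletion L)) := by
    refine ⟨hΦw.unit, isUnit_placeForm_antidiagonal_unit_mem_glInt (E := L) (N := 3) w.1 hΦw, ?_⟩
    have hf : (Matrix.of fun i j : Fin 3 => if i.val + j.val + 1 = 3 then (1 : LocalRing L v) else 0) =
        formCongr (conjLocal L (IsCMField.complexConj L) v) Tl⁻¹ ((adelicForm L 3 H').map (adeleToLocal L v)) := by
      rw [← hform, formCongr_inv_formCongr]
    have hfw := congrArg (fun M : Matrix (Fin 3) (Fin 3) (LocalRing L v) =>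
      M.map (Pi.evalRingHom (fun w' : PlacesOver L v => w'.1.adicCompletion L) w)) hf
    simp only [formCongr, Matrix.map_mul, Matrix.transpose_map, hmapw, hH'Loc, hΦLoc, ← hTlw_val, ← hTlw_inv] at hfw
    rw [IsUnit.unit_spec, IsUnit.unit_spec, placeForm_antidiagonal, hfw]
  have hL1 := exists_mem_unitaryGroupOfForm_mul_of_selfDual_of_nonsplit (IsCMField.complexConj L) w hc1 hw hv hH'w.unit hH'i
    (placeForm_hermitian_of_smul_eq (IsCMField.complexConj L) w H' hH'c hw) Tlw⁻¹ hgram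
  obtain ⟨uu, huu, k, hk, huk⟩ := hL1
  have hTlw' : Tlw = k⁻¹ * uu⁻¹ := by rw [← _root_.mul_inv_rev, ← huk, inv_inv]
  have hpos2 : 0 < Valued.v (ϖw ^ 2) := by rw [map_pow, hϖ1]; exact pow_pos (zero_lt_iff.2 WithZero.exp_ne_zero) _
  -- §7 THE REPRESENTATIVE `γ₀ := s⁻¹ t s`, `s := e_H⁻¹(u)`: `e_H(γ₀) = k · (ψ t)_w · k⁻¹ ∈ GL₃(𝒪_w)`, `≡ 1 (mod ϖ_w²)` (lemma above)
  have main := fun (t : ↥(UnitaryGroup.«local» L (IsCMField.complexConj L) 3 H' v)) (M : Matrix (Fin 3) (Fin 3) (w.1.adicCompletion L))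
      (hM : ((((ψ t).val : GL (Fin 3) (LocalRing L v)) : Matrix (Fin 3) (Fin 3) (LocalRing L v)).map
        (Pi.evalRingHom (fun w' : PlacesOver L v => w'.1.adicCompletion L) w) = M))
      (hMD : ∀ a b, Valued.v ((M - 1) a b) ≤ Valued.v (ϖw ^ 2)) =>
    exists_conj_mem_localIntegralLevel_of_literal L H' w hw t Tl (ψ t) (hψ t) k uu hk huu (by rw [← huk, hTlw]) M hM (ϖw ^ 2) hpos2 (hϖpow 2) hMD
  -- §8 THE DEPTH OF FLICKER'S LITERALS at `D = |ϖ_w|²` (★ organ §2; eigenvalues 3-deep, `|π′_w| = |ϖ_w|⁻¹`)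
  have h2ew : (2 : w.1.adicCompletion L) * e w = 1 := by have h := congrFun h2e w; simpa using h
  have hv2eq : Valued.v (2 : w.1.adicCompletion L) = 1 := (valued_two_eq_one_iff_of_placesOver L w).2 h2v
  have hew : Valued.v (e w) ≤ 1 := by
    have h := congrArg Valued.v h2ew
    rw [map_mul, hv2eq, one_mul, map_one] at h
    exact h.le
  have hpow32 : Valued.v (ϖw ^ 3) ≤ Valued.v (ϖw ^ 2) := by
    rw [map_pow, map_pow]; exact pow_le_pow_right_of_le_one' hϖlt.le (by norm_num)
  -- make `π`, `π′` opaque before evaluating the literals entrywise (keeps `simp` off the adèle structure)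
  obtain ⟨π', hπ'⟩ : ∃ π' : LocalRing L v, π' = ((hπu.unit⁻¹ : (LocalRing L v)ˣ) : LocalRing L v) := ⟨_, rfl⟩
  rw [← hπ'] at hlit₂ hlit₃ hlit₄ hπ'w
  clear_value π
  have hoff : ∀ {x₁ x₃ : w.1.adicCompletion L}, Valued.v (x₁ - 1) < Valued.v (ϖw ^ 3) → Valued.v (x₃ - 1) < Valued.v (ϖw ^ 3) →
      Valued.v ((x₁ - x₃) * π w) ≤ Valued.v (ϖw ^ 2) ∧
        Valued.v ((x₁ - x₃) * π' w) ≤ Valued.v (ϖw ^ 2) := by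
    intro x₁ x₃ h₁ h₃
    have hlt : Valued.v (x₁ - x₃) < Valued.v (ϖw ^ 3) :=
      lt_of_le_of_lt (by rw [show x₁ - x₃ = (x₁ - 1) - (x₃ - 1) by ring]; exact Valuation.map_sub _ _ _) (max_lt h₁ h₃)
    refine ⟨?_, ?_⟩
    · rw [map_mul, hπw]
      exact ((mul_le_of_le_one_right zero_le hϖlt.le).trans hlt.le).trans hpow32
    · rw [map_mul, hπ'w, map_inv₀]
      calc Valued.v (x₁ - x₃) * (Valued.v ϖw)⁻¹ ≤ Valued.v (ϖw ^ 3) * (Valued.v ϖw)⁻¹ := mul_le_mul' hlt.le le_rfl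
        _ = Valued.v (ϖw ^ 2) := by rw [map_pow, map_pow, pow_succ, mul_inv_cancel_right₀ hϖ0]
  have hxa : Valued.v (u 0 w - 1) ≤ Valued.v (ϖw ^ 2) := hda3.le.trans hpow32
  have hxd : Valued.v (u 1 w - 1) ≤ Valued.v (ϖw ^ 2) := hdd3.le.trans hpow32
  have hxb : Valued.v (finGammaTwo L v γH w - 1) ≤ Valued.v (ϖw ^ 2) := hub.le.trans hpow32
  have hoffad := hoff hda3 hdd3
  have hoffab := hoff hda3 hub
  have hoffbd := hoff hub hdd3
  obtain ⟨hπad, hπ'ad⟩ := hoffad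
  obtain ⟨hπab, hπ'ab⟩ := hoffab
  obtain ⟨hπbd, hπ'bd⟩ := hoffbd
  have hM₁ : ((((ψ t₁).val : GL (Fin 3) (LocalRing L v)) : Matrix (Fin 3) (Fin 3) (LocalRing L v)).map
      (Pi.evalRingHom (fun w' : PlacesOver L v => w'.1.adicCompletion L) w)) =
      !![e w * (u 0 w + u 1 w), 0, -(e w * (u 0 w - u 1 w)); 0, finGammaTwo L v γH w, 0; -(e w * (u 0 w - u 1 w)), 0, e w * (u 0 w + u 1 w)] := by
    rw [hlit₁]; exact map_evalRingHom_flickerLiteralOne L v w _ _ _ _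
  have hM₂ : ((((ψ t₂).val : GL (Fin 3) (LocalRing L v)) : Matrix (Fin 3) (Fin 3) (LocalRing L v)).map
      (Pi.evalRingHom (fun w' : PlacesOver L v => w'.1.adicCompletion L) w)) =
      !![e w * (u 0 w + u 1 w), 0, -(e w * (u 0 w - u 1 w) * π w); 0, finGammaTwo L v γH w, 0;
        -(e w * (u 0 w - u 1 w) * π' w), 0, e w * (u 0 w + u 1 w)] := by
    rw [hlit₂]; exact map_evalRingHom_flickerLiteralPi L v w _ _ _ _ _ _
  have hM₃ : ((((ψ t₃).val : GL (Fin 3) (LocalRing L v)) : Matrix (Fin 3) (Fin 3) (LocalRing L v)).map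
      (Pi.evalRingHom (fun w' : PlacesOver L v => w'.1.adicCompletion L) w)) =
      !![e w * (u 0 w + finGammaTwo L v γH w), 0, -(e w * (u 0 w - finGammaTwo L v γH w) * π w); 0, u 1 w, 0;
        -(e w * (u 0 w - finGammaTwo L v γH w) * π' w), 0, e w * (u 0 w + finGammaTwo L v γH w)] := by
    rw [hlit₃]; exact map_evalRingHom_flickerLiteralPi L v w _ _ _ _ _ _
  have hM₄ : ((((ψ t₄).val : GL (Fin 3) (LocalRing L v)) : Matrix (Fin 3) (Fin 3) (LocalRing L v)).map
      (Pi.evalRingHom (fun w' : PlacesOver L v => w'.1.adicCompletion L) w)) =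
      !![e w * (finGammaTwo L v γH w + u 1 w), 0, -(e w * (finGammaTwo L v γH w - u 1 w) * π w); 0, u 0 w, 0;
        -(e w * (finGammaTwo L v γH w - u 1 w) * π' w), 0, e w * (finGammaTwo L v γH w + u 1 w)] := by
    rw [hlit₄]; exact map_evalRingHom_flickerLiteralPi L v w _ _ _ _ _ _
  -- §9 CONCLUSION: support ⊆ four classes, each with a 2-deep `K`-representative
  intro cG hΔ _hmeet
  have hΔ' : finExplicitDelta L v H' γH μ (Quotient.out cG) ≠ 0 := hΔ
  have hsupp := mk_eq_or_of_finExplicitDelta_out_ne_zero L v H' γH w hw μ hn₁ hn₂ hn₃ hn₄ hHf hHd hP hu' hu'1 n12 n34 hκ₁ hκ₂ hκ₃ hκ₄ cG hΔ'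
  rcases hsupp with hc | hc | hc | hc
  · have hm := main t₁ _ hM₁ (Flicker1998.valuation_flickerLiteralOne_sub_one_le h2ew hew hxa hxb hxd)
    obtain ⟨γ₀, h1, hK, hdp⟩ := hm
    exact ⟨γ₀, h1.trans hc.symm, hK, hdp⟩
  · have hm := main t₂ _ hM₂ (Flicker1998.valuation_flickerLiteralPi_sub_one_le h2ew hew hxa hxb hxd hπad hπ'ad)
    obtain ⟨γ₀, h1, hK, hdp⟩ := hm
    exact ⟨γ₀, h1.trans hc.symm, hK, hdp⟩
  · have hm := main t₃ _ hM₃ (Flicker1998.valuation_flickerLiteralPi_sub_one_le h2ew hew hxa hxd hxb hπab hπ'ab)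
    obtain ⟨γ₀, h1, hK, hdp⟩ := hm
    exact ⟨γ₀, h1.trans hc.symm, hK, hdp⟩
  · have hm := main t₄ _ hM₄ (Flicker1998.valuation_flickerLiteralPi_sub_one_le h2ew hew hxb hxa hxd hπbd hπ'bd)
    obtain ⟨γ₀, h1, hK, hdp⟩ := hm
    exact ⟨γ₀, h1.trans hc.symm, hK, hdp⟩

set_option maxHeartbeats 400000 in
open scoped Classical in
/-- **LIFT RIDER (H2D), TYPE (1)** — END fold v3.2 `stub_twoDeepRep_typeOne` binders + conclusion VERBATIM (the neighbourhood `V` and ★ `twoDeepRep_typeOne_at`).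
[cite: Rogawski1990, §4.9 Prop. 4.9.1 (a) p. 55] [cite: Flicker1998UnitaryFL, §6 p. 97] -/
theorem exists_twoDeepRepresentative_of_finExplicitDelta_ne_zero_typeOne
    (L : Type) [Field L] [NumberField L] [IsCMField L] (H' : Matrix (Fin 3) (Fin 3) L) (μ : HeckeCharacter L)
    {v : HeightOneSpectrum (𝓞 ↥(maximalRealSubfield L))}
    (hH' : (H'.map (cmConjRingHom L)).transpose = H') (w : PlacesOver L v)
    (hw : IsCMField.complexConj L • w.1 = w.1) (hv : Algebra.IsUnramifiedIn (𝓞 L) v.asIdeal)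
    (hH'w : IsUnit (placeForm H' w.1)) (hH'i : hH'w.unit ∈ glInt 3 (w.1.adicCompletion L))
    (_hμ : μ.IsUnramifiedAt w.1) (_hμu : μ.IsUnitary)
    (_hμω : ∀ x : ideleGroup ↥(maximalRealSubfield L), μ (AdeleRing.ideleBaseChange ↥(maximalRealSubfield L) L x) = quadraticHeckeCharCM L x)
    (h2 : IsUnit (2 : 𝒪[w.1.adicCompletion L])) :
    ∃ V ∈ 𝓝 (1 : ((cmDatum L 2 (Matrix.of fun i j : Fin 2 => if i.val + j.val + 1 = 2 then (1 : L) else 0)).Local v × (cmDatum L 1 (Matrix.of fun i j : Fin 1 => if i.val + j.val + 1 = 1 then (1 : L) else 0)).Local v)), ∀ γH ∈ V, IsLocalGRegular L v γH →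
      (∃ x : w.1.adicCompletion L, (((γH.1.val : GL (Fin 2) (UnitaryGroup.LocalRing L v)).val.map
          (Pi.evalRingHom (fun w' : PlacesOver L v => w'.1.adicCompletion L) w)).charpoly).IsRoot x) →
      ¬ (∃ (y : ((cmDatum L 2 (Matrix.of fun i j : Fin 2 => if i.val + j.val + 1 = 2 then (1 : L) else 0)).Local v × (cmDatum L 1 (Matrix.of fun i j : Fin 1 => if i.val + j.val + 1 = 1 then (1 : L) else 0)).Local v)) (d' : Fin 2 → (UnitaryGroup.LocalRing L v)ˣ),
          glDiagonal 2 (UnitaryGroup.LocalRing L v) d' = ((y * γH * y⁻¹).1.val : GL (Fin 2) (UnitaryGroup.LocalRing L v))) →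
      (∀ cG : ConjClasses ((cmDatum L 3 H').Local v),
          ((finExplicitCollection L H' μ (finExplicitDelta_conj_left_all L H' μ) (finExplicitDelta_conj_right_all L H' μ)) v).Δ γH (Quotient.out cG) ≠ 0 →
          (∃ z ∈ cmLocalIntegralLevel L 3 H' v, ConjClasses.mk z = cG) →
          ∃ γ₀ : ((cmDatum L 3 H').Local v), ConjClasses.mk γ₀ = cG ∧ γ₀ ∈ cmLocalIntegralLevel L 3 H' v ∧
            (∀ a b, Valued.v (((toPlace v w (HeckeCharacter.uniformizer ↥(maximalRealSubfield L) v : v.adicCompletion ↥(maximalRealSubfield L))) ^ 2)⁻¹ *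
        ((((localNonsplitEquiv (IsCMField.complexConj L) H' (IsCMField.complexConj_ne_one L) w hw (γ₀) :
            ↥(unitaryGroupOfForm (galAdicCompletionMap (L := L) (IsCMField.complexConj L) hw) (placeForm H' w.1))) : GL (Fin 3) (w.1.adicCompletion L)) :
              Matrix (Fin 3) (Fin 3) (w.1.adicCompletion L)) a b - (1 : Matrix (Fin 3) (Fin 3) (w.1.adicCompletion L)) a b)) ≤ 1)) := by
  -- §1 THE NEIGHBOURHOOD `V`: integral (`γ_H ∈ K_H`) and 3-DEEP eigen-data (`|tr g_w − 2| < |ϖ|⁶`, `|det g_w − 1| < |ϖ|⁶`, `|u_w − 1| < |ϖ|³`)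
  have hcontg : Continuous fun γH : ((cmDatum L 2 (Matrix.of fun i j : Fin 2 => if i.val + j.val + 1 = 2 then (1 : L) else 0)).Local v ×
      (cmDatum L 1 (Matrix.of fun i j : Fin 1 => if i.val + j.val + 1 = 1 then (1 : L) else 0)).Local v) =>
      ((γH.1.val : GL (Fin 2) (UnitaryGroup.LocalRing L v)).val.map (Pi.evalRingHom (fun w' : PlacesOver L v => w'.1.adicCompletion L) w)) :=
    (Units.continuous_val.comp (continuous_subtype_val.comp continuous_fst)).matrix_map (continuous_apply w)
  have hcontu : Continuous fun γH : ((cmDatum L 2 (Matrix.of fun i j : Fin 2 => if i.val + j.val + 1 = 2 then (1 : L) else 0)).Local v ×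
      (cmDatum L 1 (Matrix.of fun i j : Fin 1 => if i.val + j.val + 1 = 1 then (1 : L) else 0)).Local v) => finGammaTwo L v γH w := by
    show Continuous fun γH : ((cmDatum L 2 (Matrix.of fun i j : Fin 2 => if i.val + j.val + 1 = 2 then (1 : L) else 0)).Local v ×
      (cmDatum L 1 (Matrix.of fun i j : Fin 1 => if i.val + j.val + 1 = 1 then (1 : L) else 0)).Local v) =>
      ((γH.2.val : GL (Fin 1) (UnitaryGroup.LocalRing L v)).val : Matrix (Fin 1) (Fin 1) (UnitaryGroup.LocalRing L v)) 0 0 w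
    exact (continuous_apply w).comp ((Units.continuous_val.comp (continuous_subtype_val.comp continuous_snd)).matrix_elem 0 0)
  set ϖw : w.1.adicCompletion L := (toPlace v w (HeckeCharacter.uniformizer ↥(maximalRealSubfield L) v : v.adicCompletion ↥(maximalRealSubfield L))) with hϖw
  have hball1 : ∀ c : w.1.adicCompletion L, {y : w.1.adicCompletion L | Valued.v (y - c) < 1} ∈ 𝓝 c := fun c =>
    (Valued.mem_nhds).2 ⟨1, fun y hy => by simpa using hy⟩
  have hball : ∀ (c : w.1.adicCompletion L) (m : ℕ), {y : w.1.adicCompletion L | Valued.v ((ϖw ^ m)⁻¹ * (y - c)) < 1} ∈ 𝓝 c := by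
    intro c m
    have hf : Continuous fun y : w.1.adicCompletion L => (ϖw ^ m)⁻¹ * (y - c) := continuous_const.mul (continuous_id.sub continuous_const)
    have h0 : {z : w.1.adicCompletion L | Valued.v (z - 0) < 1} ∈ 𝓝 ((ϖw ^ m)⁻¹ * (c - c)) := by rw [sub_self, mul_zero]; exact hball1 0
    have h := hf.continuousAt.preimage_mem_nhds h0
    simpa only [Set.preimage_setOf_eq, sub_zero] using h
  have h1g : (((1 : ((cmDatum L 2 (Matrix.of fun i j : Fin 2 => if i.val + j.val + 1 = 2 then (1 : L) else 0)).Local v ×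
      (cmDatum L 1 (Matrix.of fun i j : Fin 1 => if i.val + j.val + 1 = 1 then (1 : L) else 0)).Local v)).1.val : GL (Fin 2) (UnitaryGroup.LocalRing L v)).val.map
        (Pi.evalRingHom (fun w' : PlacesOver L v => w'.1.adicCompletion L) w)) = 1 := by
    have e : ((1 : ((cmDatum L 2 (Matrix.of fun i j : Fin 2 => if i.val + j.val + 1 = 2 then (1 : L) else 0)).Local v ×
      (cmDatum L 1 (Matrix.of fun i j : Fin 1 => if i.val + j.val + 1 = 1 then (1 : L) else 0)).Local v)).1.val : GL (Fin 2) (UnitaryGroup.LocalRing L v)).val = 1 := rfl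
    rw [e, Matrix.map_one _ (map_zero _) (map_one _)]
  have h1u : finGammaTwo L v (1 : ((cmDatum L 2 (Matrix.of fun i j : Fin 2 => if i.val + j.val + 1 = 2 then (1 : L) else 0)).Local v ×
      (cmDatum L 1 (Matrix.of fun i j : Fin 1 => if i.val + j.val + 1 = 1 then (1 : L) else 0)).Local v)) w = 1 := by
    show (((1 : ((cmDatum L 2 (Matrix.of fun i j : Fin 2 => if i.val + j.val + 1 = 2 then (1 : L) else 0)).Local v ×
      (cmDatum L 1 (Matrix.of fun i j : Fin 1 => if i.val + j.val + 1 = 1 then (1 : L) else 0)).Local v)).2.val : GL (Fin 1) (UnitaryGroup.LocalRing L v)).val :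
        Matrix (Fin 1) (Fin 1) (UnitaryGroup.LocalRing L v)) 0 0 w = 1
    have e : ((1 : ((cmDatum L 2 (Matrix.of fun i j : Fin 2 => if i.val + j.val + 1 = 2 then (1 : L) else 0)).Local v ×
      (cmDatum L 1 (Matrix.of fun i j : Fin 1 => if i.val + j.val + 1 = 1 then (1 : L) else 0)).Local v)).2.val : GL (Fin 1) (UnitaryGroup.LocalRing L v)).val = 1 := rfl
    rw [e, Matrix.one_apply_eq, Pi.one_apply]
  have hVK : (((cmLocalIntegralLevel L 2 (Matrix.of fun i j : Fin 2 => if i.val + j.val + 1 = 2 then (1 : L) else 0) v).prod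
      (cmLocalIntegralLevel L 1 (Matrix.of fun i j : Fin 1 => if i.val + j.val + 1 = 1 then (1 : L) else 0) v) : Subgroup ((cmDatum L 2 (Matrix.of fun i j : Fin 2 => if i.val + j.val + 1 = 2 then (1 : L) else 0)).Local v ×
      (cmDatum L 1 (Matrix.of fun i j : Fin 1 => if i.val + j.val + 1 = 1 then (1 : L) else 0)).Local v)) : Set ((cmDatum L 2 (Matrix.of fun i j : Fin 2 => if i.val + j.val + 1 = 2 then (1 : L) else 0)).Local v ×
      (cmDatum L 1 (Matrix.of fun i j : Fin 1 => if i.val + j.val + 1 = 1 then (1 : L) else 0)).Local v)) ∈ 𝓝 (1 : ((cmDatum L 2 (Matrix.of fun i j : Fin 2 => if i.val + j.val + 1 = 2 then (1 : L) else 0)).Local v ×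
      (cmDatum L 1 (Matrix.of fun i j : Fin 1 => if i.val + j.val + 1 = 1 then (1 : L) else 0)).Local v)) :=
    (isCompact_isOpen_cmLocalIntegralLevel_prod L 2 1 _ _ v).2.mem_nhds (Subgroup.one_mem _)
  have hVtr : {γH : ((cmDatum L 2 (Matrix.of fun i j : Fin 2 => if i.val + j.val + 1 = 2 then (1 : L) else 0)).Local v ×
      (cmDatum L 1 (Matrix.of fun i j : Fin 1 => if i.val + j.val + 1 = 1 then (1 : L) else 0)).Local v) |
      Valued.v ((ϖw ^ 6)⁻¹ * ((((γH.1.val : GL (Fin 2) (UnitaryGroup.LocalRing L v)).val.map (Pi.evalRingHom (fun w' : PlacesOver L v => w'.1.adicCompletion L) w)).trace - 2))) < 1} ∈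
        𝓝 (1 : ((cmDatum L 2 (Matrix.of fun i j : Fin 2 => if i.val + j.val + 1 = 2 then (1 : L) else 0)).Local v ×
      (cmDatum L 1 (Matrix.of fun i j : Fin 1 => if i.val + j.val + 1 = 1 then (1 : L) else 0)).Local v)) := by
    have h2 := hball (2 : w.1.adicCompletion L) 6
    have e : ((((1 : ((cmDatum L 2 (Matrix.of fun i j : Fin 2 => if i.val + j.val + 1 = 2 then (1 : L) else 0)).Local v ×
      (cmDatum L 1 (Matrix.of fun i j : Fin 1 => if i.val + j.val + 1 = 1 then (1 : L) else 0)).Local v)).1.val : GL (Fin 2) (UnitaryGroup.LocalRing L v)).val.map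
        (Pi.evalRingHom (fun w' : PlacesOver L v => w'.1.adicCompletion L) w)).trace) = 2 := by
      rw [h1g, Matrix.trace_one, Fintype.card_fin, Nat.cast_ofNat]
    have ht := hcontg.matrix_trace.continuousAt (x := 1)
    simp only [ContinuousAt] at ht
    rw [e] at ht
    exact ht h2
  have hVdet : {γH : ((cmDatum L 2 (Matrix.of fun i j : Fin 2 => if i.val + j.val + 1 = 2 then (1 : L) else 0)).Local v ×
      (cmDatum L 1 (Matrix.of fun i j : Fin 1 => if i.val + j.val + 1 = 1 then (1 : L) else 0)).Local v) |
      Valued.v ((ϖw ^ 6)⁻¹ * ((((γH.1.val : GL (Fin 2) (UnitaryGroup.LocalRing L v)).val.map (Pi.evalRingHom (fun w' : PlacesOver L v => w'.1.adicCompletion L) w)).det - 1))) < 1} ∈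
        𝓝 (1 : ((cmDatum L 2 (Matrix.of fun i j : Fin 2 => if i.val + j.val + 1 = 2 then (1 : L) else 0)).Local v ×
      (cmDatum L 1 (Matrix.of fun i j : Fin 1 => if i.val + j.val + 1 = 1 then (1 : L) else 0)).Local v)) := by
    have h1 := hball (1 : w.1.adicCompletion L) 6
    have e : ((((1 : ((cmDatum L 2 (Matrix.of fun i j : Fin 2 => if i.val + j.val + 1 = 2 then (1 : L) else 0)).Local v ×
      (cmDatum L 1 (Matrix.of fun i j : Fin 1 => if i.val + j.val + 1 = 1 then (1 : L) else 0)).Local v)).1.val : GL (Fin 2) (UnitaryGroup.LocalRing L v)).val.map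
        (Pi.evalRingHom (fun w' : PlacesOver L v => w'.1.adicCompletion L) w)).det) = 1 := by rw [h1g, Matrix.det_one]
    have ht := hcontg.matrix_det.continuousAt (x := 1)
    simp only [ContinuousAt] at ht
    rw [e] at ht
    exact ht h1
  have hVu : {γH : ((cmDatum L 2 (Matrix.of fun i j : Fin 2 => if i.val + j.val + 1 = 2 then (1 : L) else 0)).Local v ×
      (cmDatum L 1 (Matrix.of fun i j : Fin 1 => if i.val + j.val + 1 = 1 then (1 : L) else 0)).Local v) | Valued.v ((ϖw ^ 3)⁻¹ * (finGammaTwo L v γH w - 1)) < 1} ∈ 𝓝 (1 : ((cmDatum L 2 (Matrix.of fun i j : Fin 2 => if i.val + j.val + 1 = 2 then (1 : L) else 0)).Local v ×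
      (cmDatum L 1 (Matrix.of fun i j : Fin 1 => if i.val + j.val + 1 = 1 then (1 : L) else 0)).Local v)) := by
    have h1 := hball (1 : w.1.adicCompletion L) 3
    rw [← h1u] at h1
    exact hcontu.continuousAt.preimage_mem_nhds h1
  -- conversion `|(ϖ^m)⁻¹ x| < 1 ↔ |x| < |ϖ^m|`
  have hϖ1 : Valued.v ϖw = WithZero.exp (-1 : ℤ) :=
    Literature.NumberTheory.Automorphic.Liu2021.LemD1IndexedNonVacuityInertCofinite.valued_toPlace_uniformizer_of_isUnramifiedIn L v hv w
  have hconv : ∀ {x : w.1.adicCompletion L} {m : ℕ}, Valued.v ((ϖw ^ m)⁻¹ * x) < 1 → Valued.v x < Valued.v (ϖw ^ m) := by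
    intro x m h
    have hpos : 0 < Valued.v (ϖw ^ m) := by
      rw [map_pow, hϖ1]; exact pow_pos (zero_lt_iff.2 WithZero.exp_ne_zero) _
    rw [map_mul, map_inv₀, inv_mul_lt_iff₀ hpos, mul_one] at h
    exact h
  refine ⟨_, Filter.inter_mem (Filter.inter_mem (Filter.inter_mem hVK hVtr) hVdet) hVu, ?_⟩
  rintro γH ⟨⟨⟨hγK, htr⟩, hdet⟩, hub⟩ hreg hsplit hlev
  exact twoDeepRep_typeOne_at L H' μ hH' w hw hv hH'w hH'i h2 γH hγK (hconv htr) (hconv hdet) (hconv hub) hreg hsplit hlev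

end Literature.NumberTheory.Rogawski1990

end
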